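import Literature.NumberTheory.EllipticCurves.Fisher2012.HesseFamilyThreeCongruenceProofs
import Literature.NumberTheory.EllipticCurves.Fisher2012.ThreeTorsionFracLinearTransferFormula
import HarnessLib

/-!
# Fisher 2012, Theorem 13.2 (`n = 3`, direct family): the `3`-congruence WITH ITS COORDINATE FORMULA
# (cell `b2b-bsdres`, team n1011, seat p02 gen 10 — row T-E3SYMP optional file F5b)

HONEST FRAMING (cell `b2b-bsdres`, run/shared/lean/b2b/bsd-rank1-residual/, verbatim in every
file): the goal of the cell is to DELETE the COMBINATION-SHAPED residual classes of the
Birch–Swinnerton-Dyer formula for ALL analytic-rank `≤ 1` elliptic curves over `ℚ` — "full BSD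
formula for every rank `≤ 1` curve in class `C`" assembled STRICTLY from published theorems — so
that the rank-`≤ 1` remainder becomes exactly the CONSTRUCTION-SHAPED classes, which are TYPED
(missing-input `Prop`s), NOT attempted. This is not "finishing BSD". This file: our formalisation of
a published statement, with the witness displayed; no definition, no named fact.

## What this file proves

`threeCongruent_hessePencil3_formula`: for `E : y² = x³ − 27c₄x − 54c₆` over `ℚ` and a
non-singular member `E_{λ,μ}` (`hessePencil3 c₄ c₆ l m`) of its `n = 3` Hesse pencil, there is an
additive isomorphism `f : E[3] ≃ E_{λ,μ}[3]` commuting with `Γ_ℚ` AND sending the point `(x, y)` to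
`((ax + b)/(3λ − μx), 3𝔇y/(3λ − μx))`, `a = 3(λ³ − 3c₄λμ² − 2c₆μ³)`,
`b = −27μ(c₄λ² + 2c₆λμ + c₄²μ²)`, `𝔇 = λ⁴ − 6c₄λ²μ² − 8c₆λμ³ − 3c₄²μ⁴` — the tree's
`thm132_threeCongruent_hessePencil_holds` (same datum, same proof) with the formula kept.  Consumer:
the symplectic type of this congruence for the cube-root pairings (row T-E3SYMP).

References: [Fisher2012Hessian] Thm. 13.2 (n = 3), §8; [SilvermanAEC2009] III.2.3.
-/

noncomputable section

open scoped Classical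

open WeierstrassCurve Literature.NumberTheory.EllipticCurves

namespace Literature.NumberTheory.EllipticCurves.Fisher2012

/-- **Fisher 2012, Thm. 13.2 (`n = 3`), with the coordinate formula of the congruence.** See the
module docstring. [cite: Fisher2012Hessian, Thm. 13.2 (n = 3, with §8 and Def. 13.1)] -/
theorem threeCongruent_hessePencil3_formula (c₄ c₆ l m : ℚ) [hE : (c4c6Model c₄ c₆).IsElliptic]
    [hE' : (hessePencil3 c₄ c₆ l m).IsElliptic] :
    ∃ f : geomTorsion (c4c6Model c₄ c₆) (3 : ℤ) ≃+ geomTorsion (hessePencil3 c₄ c₆ l m) (3 : ℤ),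
      (∀ (σ : Field.absoluteGaloisGroup ℚ) (P : geomTorsion (c4c6Model c₄ c₆) (3 : ℤ)),
        f (σ • P) = σ • f P) ∧
      ∀ (P : geomTorsion (c4c6Model c₄ c₆) (3 : ℤ)) (x y : AlgebraicClosure ℚ)
        (h : ((c4c6Model c₄ c₆).baseChange (AlgebraicClosure ℚ)).toAffine.Nonsingular x y),
        (P : geomPoints (c4c6Model c₄ c₆)) = Affine.Point.some x y h →
        ∃ h', ((f P : geomTorsion (hessePencil3 c₄ c₆ l m) (3 : ℤ)) :
            geomPoints (hessePencil3 c₄ c₆ l m)) =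
          Affine.Point.some
            ((algebraMap ℚ (AlgebraicClosure ℚ) (3 * (l ^ 3 - 3 * c₄ * l * m ^ 2 - 2 * c₆ * m ^ 3)) * x +
                algebraMap ℚ (AlgebraicClosure ℚ) (-27 * m * (c₄ * l ^ 2 + 2 * c₆ * l * m + c₄ ^ 2 * m ^ 2))) /
              (algebraMap ℚ (AlgebraicClosure ℚ) (-m) * x + algebraMap ℚ (AlgebraicClosure ℚ) (3 * l)))
            (algebraMap ℚ (AlgebraicClosure ℚ)
                (3 * (l ^ 4 - 6 * c₄ * l ^ 2 * m ^ 2 - 8 * c₆ * l * m ^ 3 - 3 * c₄ ^ 2 * m ^ 4)) * y /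
              (algebraMap ℚ (AlgebraicClosure ℚ) (-m) * x + algebraMap ℚ (AlgebraicClosure ℚ) (3 * l))) h' := by
  -- pin the `ℚ`-algebra structure of `ℚ̄` to the one the generic transfer theorem carries
  letI : Algebra ℚ (AlgebraicClosure ℚ) := AlgebraicClosure.instAlgebra ℚ
  -- `𝔇(λ,μ) ≠ 0` (non-singular member)
  have hD : (l ^ 4 - 6 * c₄ * l ^ 2 * m ^ 2 - 8 * c₆ * l * m ^ 3 - 3 * c₄ ^ 2 * m ^ 4) ≠ 0 := by
    have h := (isElliptic_hessePencil3_iff c₄ c₆ l m).mp hE'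
    rwa [eval_hesseD3] at h
  -- the two curves over `ℚ̄`
  have hW : (c4c6Model c₄ c₆).baseChange (AlgebraicClosure ℚ) =
      ⟨0, 0, 0, -27 * algebraMap ℚ (AlgebraicClosure ℚ) c₄,
        -54 * algebraMap ℚ (AlgebraicClosure ℚ) c₆⟩ := by
    simp only [c4c6Model, WeierstrassCurve.baseChange, WeierstrassCurve.map]
    ext <;> simp
  have hW' : (hessePencil3 c₄ c₆ l m).baseChange (AlgebraicClosure ℚ) =
      ⟨0, 0, 0,
        -27 * (algebraMap ℚ (AlgebraicClosure ℚ) c₄ * algebraMap ℚ (AlgebraicClosure ℚ) l ^ 4 + 4 * algebraMap ℚ (AlgebraicClosure ℚ) c₆ * algebraMap ℚ (AlgebraicClosure ℚ) l ^ 3 * algebraMap ℚ (AlgebraicClosure ℚ) m + 6 * algebraMap ℚ (AlgebraicClosure ℚ) c₄ ^ 2 * algebraMap ℚ (AlgebraicClosure ℚ) l ^ 2 * algebraMap ℚ (AlgebraicClosure ℚ) m ^ 2 + 4 * algebraMap ℚ (AlgebraicClosure ℚ) c₄ * algebraMap ℚ (AlgebraicClosure ℚ) c₆ * algebraMap ℚ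 (AlgebraicClosure ℚ) l * algebraMap ℚ (AlgebraicClosure ℚ) m ^ 3 +
    (4 * algebraMap ℚ (AlgebraicClosure ℚ) c₆ ^ 2 - 3 * algebraMap ℚ (AlgebraicClosure ℚ) c₄ ^ 3) * algebraMap ℚ (AlgebraicClosure ℚ) m ^ 4),
        -54 * (algebraMap ℚ (AlgebraicClosure ℚ) c₆ * algebraMap ℚ (AlgebraicClosure ℚ) l ^ 6 + 6 * algebraMap ℚ (AlgebraicClosure ℚ) c₄ ^ 2 * algebraMap ℚ (AlgebraicClosure ℚ) l ^ 5 * algebraMap ℚ (AlgebraicClosure ℚ) m + 15 * algebraMap ℚ (AlgebraicClosure ℚ) c₄ * algebraMap ℚ (AlgebraicClosure ℚ) c₆ * algebraMap ℚ (AlgebraicClosure ℚ) l ^ 4 * algebraMap ℚ (AlgebraicClosure ℚ) m ^ 2 + 20 * algebraMap ℚ (AlgebraicClosure ℚ) c₆ ^ 2 * algebraMap ℚ (AlgebraicClosure ℚ) l ^ 3 * algebraMap ℚ (AlgebraicClosure ℚ) m ^ 3 +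
    15 * algebraMap ℚ (AlgebraicClosure ℚ) c₄ ^ 2 * algebraMap ℚ (AlgebraicClosure ℚ) c₆ * algebraMap ℚ (AlgebraicClosure ℚ) l ^ 2 * algebraMap ℚ (AlgebraicClosure ℚ) m ^ 4 + (18 * algebraMap ℚ (AlgebraicClosure ℚ) c₄ ^ 4 - 12 * algebraMap ℚ (AlgebraicClosure ℚ) c₄ * algebraMap ℚ (AlgebraicClosure ℚ) c₆ ^ 2) * algebraMap ℚ (AlgebraicClosure ℚ) l * algebraMap ℚ (AlgebraicClosure ℚ) m ^ 5 +
    (9 * algebraMap ℚ (AlgebraicClosure ℚ) c₄ ^ 3 * algebraMap ℚ (AlgebraicClosure ℚ) c₆ - 8 * algebraMap ℚ (AlgebraicClosure ℚ) c₆ ^ 3) * algebraMap ℚ (AlgebraicClosure ℚ) m ^ 6)⟩ := by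
    rw [hessePencil3_eq]
    simp only [WeierstrassCurve.baseChange, WeierstrassCurve.map]
    ext <;> simp
  have hDb : (algebraMap ℚ (AlgebraicClosure ℚ) l ^ 4 - 6 * algebraMap ℚ (AlgebraicClosure ℚ) c₄ * algebraMap ℚ (AlgebraicClosure ℚ) l ^ 2 * algebraMap ℚ (AlgebraicClosure ℚ) m ^ 2 - 8 * algebraMap ℚ (AlgebraicClosure ℚ) c₆ * algebraMap ℚ (AlgebraicClosure ℚ) l * algebraMap ℚ (AlgebraicClosure ℚ) m ^ 3 - 3 * algebraMap ℚ (AlgebraicClosure ℚ) c₄ ^ 2 * algebraMap ℚ (AlgebraicClosure ℚ) m ^ 4) ≠ 0 := by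
    have e : (algebraMap ℚ (AlgebraicClosure ℚ) l ^ 4 - 6 * algebraMap ℚ (AlgebraicClosure ℚ) c₄ * algebraMap ℚ (AlgebraicClosure ℚ) l ^ 2 * algebraMap ℚ (AlgebraicClosure ℚ) m ^ 2 - 8 * algebraMap ℚ (AlgebraicClosure ℚ) c₆ * algebraMap ℚ (AlgebraicClosure ℚ) l * algebraMap ℚ (AlgebraicClosure ℚ) m ^ 3 - 3 * algebraMap ℚ (AlgebraicClosure ℚ) c₄ ^ 2 * algebraMap ℚ (AlgebraicClosure ℚ) m ^ 4) =
        algebraMap ℚ (AlgebraicClosure ℚ) ((l ^ 4 - 6 * c₄ * l ^ 2 * m ^ 2 - 8 * c₆ * l * m ^ 3 - 3 * c₄ ^ 2 * m ^ 4)) := by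
      simp only [map_sub, map_mul, map_pow, map_ofNat]
    rw [e]
    exact (map_ne_zero _).mpr hD
  -- the datum `(a, b, c, d, e)` over `ℚ`
  have ha : algebraMap ℚ (AlgebraicClosure ℚ) (3 * (l ^ 3 - 3 * c₄ * l * m ^ 2 - 2 * c₆ * m ^ 3)) =
      3 * ((algebraMap ℚ (AlgebraicClosure ℚ) l) ^ 3
        - 3 * algebraMap ℚ (AlgebraicClosure ℚ) c₄ * algebraMap ℚ (AlgebraicClosure ℚ) l *
          (algebraMap ℚ (AlgebraicClosure ℚ) m) ^ 2
        - 2 * algebraMap ℚ (AlgebraicClosure ℚ) c₆ * (algebraMap ℚ (AlgebraicClosure ℚ) m) ^ 3) := by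
    simp only [map_sub, map_mul, map_pow, map_ofNat]
  have hb : algebraMap ℚ (AlgebraicClosure ℚ) (-27 * m * (c₄ * l ^ 2 + 2 * c₆ * l * m + c₄ ^ 2 * m ^ 2)) =
      -27 * algebraMap ℚ (AlgebraicClosure ℚ) m *
        (algebraMap ℚ (AlgebraicClosure ℚ) c₄ * (algebraMap ℚ (AlgebraicClosure ℚ) l) ^ 2
          + 2 * algebraMap ℚ (AlgebraicClosure ℚ) c₆ * algebraMap ℚ (AlgebraicClosure ℚ) l *
            algebraMap ℚ (AlgebraicClosure ℚ) m
          + (algebraMap ℚ (AlgebraicClosure ℚ) c₄) ^ 2 * (algebraMap ℚ (AlgebraicClosure ℚ) m) ^ 2) := by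
    simp only [map_add, map_mul, map_pow, map_neg, map_ofNat]
  have hc : algebraMap ℚ (AlgebraicClosure ℚ) (3 * (l ^ 4 - 6 * c₄ * l ^ 2 * m ^ 2 - 8 * c₆ * l * m ^ 3 - 3 * c₄ ^ 2 * m ^ 4)) =
      3 * (algebraMap ℚ (AlgebraicClosure ℚ) l ^ 4 - 6 * algebraMap ℚ (AlgebraicClosure ℚ) c₄ * algebraMap ℚ (AlgebraicClosure ℚ) l ^ 2 * algebraMap ℚ (AlgebraicClosure ℚ) m ^ 2 - 8 * algebraMap ℚ (AlgebraicClosure ℚ) c₆ * algebraMap ℚ (AlgebraicClosure ℚ) l * algebraMap ℚ (AlgebraicClosure ℚ) m ^ 3 - 3 * algebraMap ℚ (AlgebraicClosure ℚ) c₄ ^ 2 * algebraMap ℚ (AlgebraicClosure ℚ) m ^ 4) := by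
    simp only [map_sub, map_mul, map_pow, map_ofNat]
  have hd : algebraMap ℚ (AlgebraicClosure ℚ) (-m) = -algebraMap ℚ (AlgebraicClosure ℚ) m :=
    map_neg _ _
  have he : algebraMap ℚ (AlgebraicClosure ℚ) (3 * l) = 3 * algebraMap ℚ (AlgebraicClosure ℚ) l := by
    simp only [map_mul, map_ofNat]
  obtain ⟨f, hf, hform⟩ := threeCongruent_of_fracLinearDatum_formula (K := ℚ) (c4c6Model c₄ c₆)
    (hessePencil3 c₄ c₆ l m) rfl rfl rfl rfl
    (3 * (l ^ 3 - 3 * c₄ * l * m ^ 2 - 2 * c₆ * m ^ 3))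
    (-27 * m * (c₄ * l ^ 2 + 2 * c₆ * l * m + c₄ ^ 2 * m ^ 2)) (3 * (l ^ 4 - 6 * c₄ * l ^ 2 * m ^ 2 - 8 * c₆ * l * m ^ 3 - 3 * c₄ ^ 2 * m ^ 4)) (-m) (3 * l)
    (by rw [hesse3_det]; exact mul_ne_zero (by norm_num) hD)
    (mul_ne_zero three_ne_zero hD)
    (by
      intro x hx
      rw [hW] at hx
      rw [hd, he]
      exact hesse3_den_ne_zero _ _ _ _ hDb hx)
    (by
      intro x hx
      rw [hW] at hx
      rw [hW']
      exact hesse3_eval_Ψ₃_eq_zero _ _ _ _ _ _ _ _ ha hb hd he hDb hx)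
    (by
      intro x y hxy hx
      rw [hW] at hx hxy
      rw [hW']
      exact hesse3_equation _ _ _ _ _ _ _ _ _ ha hb hc hd he hDb hxy hx)
  exact ⟨f, hf, hform⟩

end Literature.NumberTheory.EllipticCurves.Fisher2012

end
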